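import Literature.NumberTheory.Automorphic.UnitaryRankTwoDepthExpansionRamifiedModular      -- ★-to-be A-p03 (g26) V2: the generic ramified VERTEX head `finsum_fixedBy_conj_eq_signedDepthExpansion_ramified_modular`
import Literature.NumberTheory.Automorphic.FixedCosetsModularLatticesSep                    -- ★ p843798 A-p03 (g26) V1: `finite_fixedBy_conj_unitary_of_finite`, `exists_mem_unitary_span_mul_eq_iff_modular`
import Literature.NumberTheory.Automorphic.SelfDualStableLatticeDepthCountRamifiedCM       -- ★ p843774 A-p01 (g21) R2-E: `finite_modularStable_antidiagTwo_at_ramified`, `exists_integer_involution_complexConj_of_ramified`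
import Literature.NumberTheory.Automorphic.UnitaryCompactElementVertexLatticeRamified      -- ★ p843555 A-p03 (g26) I-5a-ram FILE D: `exists_mem_unitaryGroupOfForm_mul_glDiagonal_mul_of_modular_of_ramified` (vertex docking)
import Literature.NumberTheory.Rogawski1990.RankOneKappaOrbitalDepthExpansionRamifiedH     -- ★ p843814 A-p13 (g32) α4 (EDGE twin): brings ★ I-7, ★ asm, ★ S0-ram
import HarnessLib

/-!
# (R5b-α) V3 — THE PER-PIECE SIGNED DEPTH EXPANSION of a localised orbital integral on `H_v = U(Φ₂)(L⁺_v) × U(Φ₁)(L⁺_v)` at a TAMELY RAMIFIED place,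
# VERTEX piece (`K ↔ K♯_D = U ∩ D GL₂(𝒪_w) D⁻¹`, `D = diag(1, ϖ)`, through the one-place model): the CM dress of ★-to-be A-p03 V2 + the `H_v` reading ★ I-7 — the `K♯` twin of
★ α4 (road «R1-ram», architect RULINGS A-23 (b), A-25 (b); END assembler F0P3a-p03 (g12); R5b-PAIR F0P3-p01 (g14) «=» 11:15:53Z; typist A-p13 (g32))

Topic `NumberTheory/Rogawski1990`; namespace `Literature.NumberTheory.Rogawski1990`.  THEOREMS ONLY (no definition, no instance, no notation, no named fact, no `sorry`);
kernel lane `--supports stmt-HodgeConjecture-24833`.  Cell `pub/hodgecm-mathlib` (D-0151), crux H413, residue `RankOneUnstableTransferNonsplitCMERamified` of #159.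
HONEST LABEL: HC_CM is proved only modulo the 2 remaining named inputs (hLiu418, h413) until rung 0 closes; this file is bookkeeping between ★ theorems.

THE STATEMENT is F0P3-p01 (g14)'s V3 stub VERBATIM (`F0/P3/F0P3-p01/g14/V3-STUB.statement.F0P3p01g14.lean`): ★ α4's ∃-head with `(D : GL₂ L_w) (hD : ↑D = !![1,0;0,ϖ])`
after `hη`, the `K♯_D` dictionary `g ∈ K ↔ E₂ g ∈ ((GL₂(𝒪_w)).map (conj D)).subgroupOf U`, the CONJUGATED level law `hKm` (level `m` of `D⁻¹ y D`), EVEN `i`, the vertex sign token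
`(−1)^{(N+i+1)∕2+1}·u₁·((u₀−u₁)ϖ^{−N})·(−h₀)` (B-p12 (g29) 10:33:18Z), the `D`-conjugated value points `u₁·(1 + ϖ^i·(D [[0,η^{e i}],[0,0]] D⁻¹))`, parity-`1` weights
`#B_i(N) = 2q_v^{(N−1−i)∕2}`:
**`integral_conj_eq_smul_signedDepthExpansion_onePlace_ramified_modular`** = ★ I-7 `integral_conj_eq_smul_finsum_onePlace_of_isCompact` (at `K′ := K♯_D`) ∘ ★-to-be A-p03 V2
`finsum_fixedBy_conj_eq_signedDepthExpansion_ramified_modular`, with V2's hypotheses DISCHARGED at `w`: the vertex docking `hB` (★ A-p03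
`exists_mem_unitaryGroupOfForm_mul_glDiagonal_mul_of_modular_of_ramified` at `η := ϖ`), `hfin` (★ V1 `finite_fixedBy_conj_unitary_of_finite` + ★ V1 docking
`exists_mem_unitary_span_mul_eq_iff_modular` + ★ R2-E `finite_modularStable_antidiagTwo_at_ramified`), `hq = q_v`, DVR ∕ `2 ∈ 𝒪ˣ`; and its CHOICE-FREE twin `…_of_coe_eq`.

## References
* [LabesseLanglands1979] J.-P. Labesse, R. P. Langlands, *L-indistinguishability for SL(2)*, Canad. J. Math. 31 (1979): §2 Lemma 2.1 pp. 8–9.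
* [Rogawski1990] J. D. Rogawski, *Automorphic Representations of Unitary Groups in Three Variables*, Ann. of Math. Stud. 123 (1990): §4.9 pp. 54–56, Lemma 4.9.3.
* [Kottwitz1988] R. E. Kottwitz, *Tamagawa numbers*, Ann. of Math. 127 (1988): §2.
-/

set_option autoImplicit false

noncomputable section

open MeasureTheory Topology Set Function MulAction NumberField IsDedekindDomain Matrix Finset ValuativeRel
open scoped MatrixGroups ValuativeRel

namespace Literature.NumberTheory.Rogawski1990

open Literature.NumberTheory.Automorphic Literature.NumberTheory.Automorphic.UnitaryGroup Literature.NumberTheory.GaloisRepresentations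

section Sharp

/-- The swapped skew matrix `[[0,1],[−1,0]]` lies in `GL₂(𝒪)` (entries and inverse entries `0, ±1`). [cite: Jacobowitz1962, §4] -/
private theorem exists_glInt_coe_eq_sharp' {F : Type*} [Field F] [ValuativeRel F] :
    ∃ J' ∈ glInt 2 F, (J' : Matrix (Fin 2) (Fin 2) F) = !![0, 1; -1, 0] := by
  have h1 : (!![(0 : F), 1; -1, 0] : Matrix (Fin 2) (Fin 2) F) * !![0, -1; 1, 0] = 1 := by
    ext i j; fin_cases i <;> fin_cases j <;> simp
  have h2 : (!![(0 : F), -1; 1, 0] : Matrix (Fin 2) (Fin 2) F) * !![0, 1; -1, 0] = 1 := by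
    ext i j; fin_cases i <;> fin_cases j <;> simp
  refine ⟨⟨!![0, 1; -1, 0], !![0, -1; 1, 0], h1, h2⟩, (mem_glInt_iff _).2 ⟨fun r s => ?_, fun r s => ?_⟩, rfl⟩
  · fin_cases r <;> fin_cases s <;>
      simp only [Matrix.of_apply, Matrix.cons_val', Matrix.cons_val_zero, Matrix.cons_val_one, Matrix.cons_val_fin_one, Fin.zero_eta, Fin.mk_one] <;>
      first | exact zero_mem _ | exact one_mem _ | exact neg_mem (one_mem _)
  · show (!![(0 : F), -1; 1, 0] : Matrix (Fin 2) (Fin 2) F) r s ∈ 𝒪[F]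
    fin_cases r <;> fin_cases s <;>
      simp only [Matrix.of_apply, Matrix.cons_val', Matrix.cons_val_zero, Matrix.cons_val_one, Matrix.cons_val_fin_one, Fin.zero_eta, Fin.mk_one] <;>
      first | exact zero_mem _ | exact one_mem _ | exact neg_mem (one_mem _)

end Sharp

section Expansion

variable (L : Type) [Field L] [NumberField L] [IsCMField L] (v : HeightOneSpectrum (𝓞 ↥(maximalRealSubfield L)))
  (w : PlacesOver L v) (hw : IsCMField.complexConj L • w.1 = w.1)
  [MeasurableSpace ((cmDatum L 2 (Matrix.of fun i j : Fin 2 => if i.val + j.val + 1 = 2 then (1 : L) else 0)).Local v × (cmDatum L 1 (Matrix.of fun i j : Fin 1 => if i.val + j.val + 1 = 1 then (1 : L) else 0)).Local v)] [BorelSpace ((cmDatum L 2 (Matrix.of fun i j : Fin 2 => if i.val + j.val + 1 = 2 then (1 : L) else 0)).Local v × (cmDatum L 1 (Matrix.of fun i j : Fin 1 => if i.val + j.val + 1 = 1 then (1 : L) else 0)).Local v)] (ν : Measure ((cmDatum L 2 (Matrix.of fun i j : Fin 2 => if i.val + j.val + 1 = 2 then (1 : L) else 0)).Local v × (cmDatum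 L 1 (Matrix.of fun i j : Fin 1 => if i.val + j.val + 1 = 1 then (1 : L) else 0)).Local v)) [ν.IsMulRightInvariant]
  {E : Type*} [NormedAddCommGroup E] [NormedSpace ℝ E] [CompleteSpace E]

-- `L_w`-sized statement: elaboration budget only (no search)
set_option maxHeartbeats 1600000 in
set_option synthInstance.maxHeartbeats 200000 in
include hw in
/-- **V3 — THE PER-PIECE SIGNED DEPTH EXPANSION ON `H_v` AT A TAMELY RAMIFIED PLACE, VERTEX PIECE `K♯_D`.**  See the module docstring (F0P3-p01 (g14)'s V3 stub verbatim).
[cite: LabesseLanglands1979, §2 Lemma 2.1 pp. 8–9] [cite: Rogawski1990, §4.9 pp. 54–56, Lemma 4.9.3] [cite: Kottwitz1988, §2] -/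
theorem integral_conj_eq_smul_signedDepthExpansion_onePlace_ramified_modular
    (he : v.asIdeal.ramificationIdx' w.1.asIdeal ≠ 1) (h2 : Valued.v (2 : w.1.adicCompletion L) = 1)
    (ϖ : (w.1.adicCompletion L)ˣ) (hϖ : Valued.v (ϖ : w.1.adicCompletion L) = WithZero.exp (-1 : ℤ)) (hσϖ : galAdicCompletionMap (L := L) (IsCMField.complexConj L) hw (ϖ : w.1.adicCompletion L) = -(ϖ : w.1.adicCompletion L))
    (σO : 𝒪[w.1.adicCompletion L] →+* 𝒪[w.1.adicCompletion L]) (hσO' : ∀ x : 𝒪[w.1.adicCompletion L], ((σO x : 𝒪[w.1.adicCompletion L]) : w.1.adicCompletion L) = galAdicCompletionMap (L := L) (IsCMField.complexConj L) hw x)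
    (hσσ : ∀ x, σO (σO x) = x) (hres : ∀ x : 𝒪[w.1.adicCompletion L], σO x - x ∈ IsLocalRing.maximalIdeal 𝒪[w.1.adicCompletion L])
    {η : 𝒪[w.1.adicCompletion L]} (hηu : IsUnit η) (hση : σO η = η) (hη : ¬ IsSquare (IsLocalRing.residue 𝒪[w.1.adicCompletion L] η))
    (D : GL (Fin 2) (w.1.adicCompletion L)) (hD : (D : Matrix (Fin 2) (Fin 2) (w.1.adicCompletion L)) = !![1, 0; 0, (ϖ : w.1.adicCompletion L)])
    (K : Subgroup ((cmDatum L 2 (Matrix.of fun i j : Fin 2 => if i.val + j.val + 1 = 2 then (1 : L) else 0)).Local v)) (E₂ : (cmDatum L 2 (Matrix.of fun i j : Fin 2 => if i.val + j.val + 1 = 2 then (1 : L) else 0)).Local v ≃ₜ* ↥(unitaryGroupOfForm (galAdicCompletionMap (L := L) (IsCMField.complexConj L) hw) (placeForm (Matrix.of fun i j : Fin 2 => if i.val + j.val + 1 = 2 then (1 : L) else 0) w.1))) (hK : ∀ g, g ∈ K ↔ E₂ g ∈ ((glInt 2 (w.1.adicCompletion L)).map (MulAut.conj D).toMonoidHom).subgroupOf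 (unitaryGroupOfForm (galAdicCompletionMap (L := L) (IsCMField.complexConj L) hw) (placeForm (Matrix.of fun i j : Fin 2 => if i.val + j.val + 1 = 2 then (1 : L) else 0) w.1)))
    (hKo : IsOpen ((K.prod (⊤ : Subgroup ((cmDatum L 1 (Matrix.of fun i j : Fin 1 => if i.val + j.val + 1 = 1 then (1 : L) else 0)).Local v)) : Subgroup ((cmDatum L 2 (Matrix.of fun i j : Fin 2 => if i.val + j.val + 1 = 2 then (1 : L) else 0)).Local v × (cmDatum L 1 (Matrix.of fun i j : Fin 1 => if i.val + j.val + 1 = 1 then (1 : L) else 0)).Local v)) : Set ((cmDatum L 2 (Matrix.of fun i j : Fin 2 => if i.val + j.val + 1 = 2 then (1 : L) else 0)).Local v × (cmDatum L 1 (Matrix.of fun i j : Fin 1 => if i.val + j.val + 1 = 1 then (1 : L) else 0)).Local v)))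
    (hKν : ν ((K.prod (⊤ : Subgroup ((cmDatum L 1 (Matrix.of fun i j : Fin 1 => if i.val + j.val + 1 = 1 then (1 : L) else 0)).Local v)) : Subgroup ((cmDatum L 2 (Matrix.of fun i j : Fin 2 => if i.val + j.val + 1 = 2 then (1 : L) else 0)).Local v × (cmDatum L 1 (Matrix.of fun i j : Fin 1 => if i.val + j.val + 1 = 1 then (1 : L) else 0)).Local v)) : Set ((cmDatum L 2 (Matrix.of fun i j : Fin 2 => if i.val + j.val + 1 = 2 then (1 : L) else 0)).Local v × (cmDatum L 1 (Matrix.of fun i j : Fin 1 => if i.val + j.val + 1 = 1 then (1 : L) else 0)).Local v)) ≠ ⊤)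
    (x : ((cmDatum L 2 (Matrix.of fun i j : Fin 2 => if i.val + j.val + 1 = 2 then (1 : L) else 0)).Local v × (cmDatum L 1 (Matrix.of fun i j : Fin 1 => if i.val + j.val + 1 = 1 then (1 : L) else 0)).Local v)) {Q : GL (Fin 2) (w.1.adicCompletion L)} {u : Fin 2 → w.1.adicCompletion L}
    (hQ : (((E₂ x.1 : ↥(unitaryGroupOfForm (galAdicCompletionMap (L := L) (IsCMField.complexConj L) hw) (placeForm (Matrix.of fun i j : Fin 2 => if i.val + j.val + 1 = 2 then (1 : L) else 0) w.1))) : GL (Fin 2) (w.1.adicCompletion L)) : Matrix (Fin 2) (Fin 2) (w.1.adicCompletion L)) * (Q : Matrix (Fin 2) (Fin 2) (w.1.adicCompletion L)) = (Q : Matrix (Fin 2) (Fin 2) (w.1.adicCompletion L)) * diagonal u) (hu : Function.Injective u)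
    (hu1 : ∀ i, galAdicCompletionMap (L := L) (IsCMField.complexConj L) hw (u i) * u i = 1) {N : ℕ} (hN : Valued.v (u 0 - u 1) = Valued.v (ϖ : w.1.adicCompletion L) ^ N)
    {h : Fin 2 → w.1.adicCompletion L} (hQh : formCongr (galAdicCompletionMap (L := L) (IsCMField.complexConj L) hw) Q (placeForm (Matrix.of fun i j : Fin 2 => if i.val + j.val + 1 = 2 then (1 : L) else 0) w.1) = Matrix.diagonal h) (hh : ∀ i, Valued.v (h i) = 1)
    (hσh : ∀ i, galAdicCompletionMap (L := L) (IsCMField.complexConj L) hw (h i) = h i) (r : 𝒪[w.1.adicCompletion L]) (hr : h 0 * (r : w.1.adicCompletion L) = -h 1) (hsq : IsSquare (IsLocalRing.residue 𝒪[w.1.adicCompletion L] r))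
    {m : ℕ} (hmN : m ≤ N) (Km : Subgroup ↥(unitaryGroupOfForm (galAdicCompletionMap (L := L) (IsCMField.complexConj L) hw) (placeForm (Matrix.of fun i j : Fin 2 => if i.val + j.val + 1 = 2 then (1 : L) else 0) w.1)))
    (hKm : ∀ y : ↥(unitaryGroupOfForm (galAdicCompletionMap (L := L) (IsCMField.complexConj L) hw) (placeForm (Matrix.of fun i j : Fin 2 => if i.val + j.val + 1 = 2 then (1 : L) else 0) w.1)), (∀ r s, (ϖ : w.1.adicCompletion L) ^ (-(m : ℤ)) *
      ((((D⁻¹ * ((y : ↥(unitaryGroupOfForm (galAdicCompletionMap (L := L) (IsCMField.complexConj L) hw) (placeForm (Matrix.of fun i j : Fin 2 => if i.val + j.val + 1 = 2 then (1 : L) else 0) w.1))) : GL (Fin 2) (w.1.adicCompletion L)) * D : GL (Fin 2) (w.1.adicCompletion L))) : Matrix (Fin 2) (Fin 2) (w.1.adicCompletion L)) - 1) r s ∈ 𝒪[w.1.adicCompletion L]) → y ∈ Km)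
    (φ : ((cmDatum L 2 (Matrix.of fun i j : Fin 2 => if i.val + j.val + 1 = 2 then (1 : L) else 0)).Local v × (cmDatum L 1 (Matrix.of fun i j : Fin 1 => if i.val + j.val + 1 = 1 then (1 : L) else 0)).Local v) → E) (hφs : support φ ⊆ ((K.prod (⊤ : Subgroup ((cmDatum L 1 (Matrix.of fun i j : Fin 1 => if i.val + j.val + 1 = 1 then (1 : L) else 0)).Local v)) : Subgroup ((cmDatum L 2 (Matrix.of fun i j : Fin 2 => if i.val + j.val + 1 = 2 then (1 : L) else 0)).Local v × (cmDatum L 1 (Matrix.of fun i j : Fin 1 => if i.val + j.val + 1 = 1 then (1 : L) else 0)).Local v)) : Set ((cmDatum L 2 (Matrix.of fun i j : Fin 2 => if i.val + j.val + 1 = 2 then (1 : L) else 0)).Local v × (cmDatum L 1 (Matrix.of fun i j : Fin 1 => if i.val + j.val + 1 = 1 then (1 : L) else 0)).Local v)))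
    (hφK : ∀ k ∈ (K.prod (⊤ : Subgroup ((cmDatum L 1 (Matrix.of fun i j : Fin 1 => if i.val + j.val + 1 = 1 then (1 : L) else 0)).Local v)) : Subgroup ((cmDatum L 2 (Matrix.of fun i j : Fin 2 => if i.val + j.val + 1 = 2 then (1 : L) else 0)).Local v × (cmDatum L 1 (Matrix.of fun i j : Fin 1 => if i.val + j.val + 1 = 1 then (1 : L) else 0)).Local v)), ∀ y, φ (k * y * k⁻¹) = φ y)
    (hφm : ∀ x' : ↥(unitaryGroupOfForm (galAdicCompletionMap (L := L) (IsCMField.complexConj L) hw) (placeForm (Matrix.of fun i j : Fin 2 => if i.val + j.val + 1 = 2 then (1 : L) else 0) w.1)), ∀ y ∈ Km, φ (E₂.symm (x' * y), x.2) = φ (E₂.symm x', x.2))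
    (hc : IsCompact {y : ((cmDatum L 2 (Matrix.of fun i j : Fin 2 => if i.val + j.val + 1 = 2 then (1 : L) else 0)).Local v × (cmDatum L 1 (Matrix.of fun i j : Fin 1 => if i.val + j.val + 1 = 1 then (1 : L) else 0)).Local v) | y * x * y⁻¹ ∈ ((K.prod (⊤ : Subgroup ((cmDatum L 1 (Matrix.of fun i j : Fin 1 => if i.val + j.val + 1 = 1 then (1 : L) else 0)).Local v)) : Subgroup ((cmDatum L 2 (Matrix.of fun i j : Fin 2 => if i.val + j.val + 1 = 2 then (1 : L) else 0)).Local v × (cmDatum L 1 (Matrix.of fun i j : Fin 1 => if i.val + j.val + 1 = 1 then (1 : L) else 0)).Local v)) : Set ((cmDatum L 2 (Matrix.of fun i j : Fin 2 => if i.val + j.val + 1 = 2 then (1 : L) else 0)).Local v × (cmDatum L 1 (Matrix.of fun i j : Fin 1 => if i.val + j.val + 1 = 1 then (1 : L) else 0)).Local v))}) :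
    ∃ (e : ℕ → ℕ) (xm : ↥(unitaryGroupOfForm (galAdicCompletionMap (L := L) (IsCMField.complexConj L) hw) (placeForm (Matrix.of fun i j : Fin 2 => if i.val + j.val + 1 = 2 then (1 : L) else 0) w.1))) (xs : ℕ → ↥(unitaryGroupOfForm (galAdicCompletionMap (L := L) (IsCMField.complexConj L) hw) (placeForm (Matrix.of fun i j : Fin 2 => if i.val + j.val + 1 = 2 then (1 : L) else 0) w.1))), (∀ i, e i ≤ 1) ∧
      (∀ i < m, Even i → ∀ S : 𝒪[w.1.adicCompletion L], (S : w.1.adicCompletion L) = (-1) ^ ((N + i + 1) / 2 + 1) * u 1 * ((u 0 - u 1) * ((ϖ : w.1.adicCompletion L) ^ N)⁻¹) * (-h 0) →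
        (e i = 0 ↔ IsSquare (IsLocalRing.residue 𝒪[w.1.adicCompletion L] S))) ∧
      (((xm : ↥(unitaryGroupOfForm (galAdicCompletionMap (L := L) (IsCMField.complexConj L) hw) (placeForm (Matrix.of fun i j : Fin 2 => if i.val + j.val + 1 = 2 then (1 : L) else 0) w.1))) : GL (Fin 2) (w.1.adicCompletion L)) : Matrix (Fin 2) (Fin 2) (w.1.adicCompletion L)) = u 1 • (1 : Matrix (Fin 2) (Fin 2) (w.1.adicCompletion L)) ∧
      (∀ i, Even i → (((xs i : ↥(unitaryGroupOfForm (galAdicCompletionMap (L := L) (IsCMField.complexConj L) hw) (placeForm (Matrix.of fun i j : Fin 2 => if i.val + j.val + 1 = 2 then (1 : L) else 0) w.1))) : GL (Fin 2) (w.1.adicCompletion L)) : Matrix (Fin 2) (Fin 2) (w.1.adicCompletion L)) = u 1 • ((1 : Matrix (Fin 2) (Fin 2) (w.1.adicCompletion L)) +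
        (ϖ : w.1.adicCompletion L) ^ i • ((D : Matrix (Fin 2) (Fin 2) (w.1.adicCompletion L)) * !![0, ((η : 𝒪[w.1.adicCompletion L]) : w.1.adicCompletion L) ^ (e i); 0, 0] * ((D⁻¹ : GL (Fin 2) (w.1.adicCompletion L)) : Matrix (Fin 2) (Fin 2) (w.1.adicCompletion L))))) ∧
      ∫ y, φ (y * x * y⁻¹) ∂ν = ν.real ((K.prod (⊤ : Subgroup ((cmDatum L 1 (Matrix.of fun i j : Fin 1 => if i.val + j.val + 1 = 1 then (1 : L) else 0)).Local v)) : Subgroup ((cmDatum L 2 (Matrix.of fun i j : Fin 2 => if i.val + j.val + 1 = 2 then (1 : L) else 0)).Local v × (cmDatum L 1 (Matrix.of fun i j : Fin 1 => if i.val + j.val + 1 = 1 then (1 : L) else 0)).Local v)) : Set ((cmDatum L 2 (Matrix.of fun i j : Fin 2 => if i.val + j.val + 1 = 2 then (1 : L) else 0)).Local v × (cmDatum L 1 (Matrix.of fun i j : Fin 1 => if i.val + j.val + 1 = 1 then (1 : L) else 0)).Local v)) •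
        ((∑ j ∈ (range (N + 1)).filter (fun j => j % 2 = 1 ∧ j + m ≤ N), (if j = 0 then 1 else 2 * Nat.card (𝓞 ↥(maximalRealSubfield L) ⧸ v.asIdeal) ^ (j / 2))) • φ (E₂.symm xm, x.2) +
          ∑ i ∈ range m, (if i ≤ N ∧ (N - i) % 2 = 1 then (if N - i = 0 then 1 else 2 * Nat.card (𝓞 ↥(maximalRealSubfield L) ⧸ v.asIdeal) ^ ((N - i) / 2)) else 0) • φ (E₂.symm (xs i), x.2)) := by
  classical
  have hc1 : IsCMField.complexConj L ≠ 1 := IsCMField.complexConj_ne_one L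
  -- §a the generic data of ★ V2 at `w`
  have hϖ0 : (ϖ : w.1.adicCompletion L) ≠ 0 := ϖ.ne_zero
  have hϖ' : IsUniformizingElement (ϖ : w.1.adicCompletion L) := isUniformizingElement_of_v_eq hϖ
  haveI : IsDiscreteValuationRing 𝒪[w.1.adicCompletion L] := isDiscreteValuationRing_integer_of_compatible hϖ
  have h2O : IsUnit (2 : 𝒪[w.1.adicCompletion L]) := by
    rw [(Valuation.integer.integers (valuation (w.1.adicCompletion L))).isUnit_iff_valuation_eq_one, map_ofNat]
    exact (v_eq_one_iff_valuation_eq_one (2 : w.1.adicCompletion L)).1 h2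
  obtain ⟨-, -, -, -, hq⟩ := exists_integer_involution_complexConj_of_ramified L v w hw he
  have huv : ∀ i, valuation (w.1.adicCompletion L) (u i) = 1 := fun i => valuation_eq_one_of_galAdicCompletionMap_mul_self L v w hw (hu1 i)
  have hN' : valuation (w.1.adicCompletion L) (u 0 - u 1) = valuation (w.1.adicCompletion L) ((ϖ : w.1.adicCompletion L) ^ N) := by rw [← v_eq_iff_valuation_eq, hN, map_pow]
  have hh' : ∀ i, valuation (w.1.adicCompletion L) (h i) = 1 := fun i => (v_eq_one_iff_valuation_eq_one (h i)).1 (hh i)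
  have hJ : (((isUnit_placeForm_antidiagOne (E := L) 2 w.1).unit : GL (Fin 2) (w.1.adicCompletion L)) : Matrix (Fin 2) (Fin 2) (w.1.adicCompletion L)) = !![0, 1; 1, 0] :=
    placeForm_antidiagTwo_eq_swap_lit L v w
  -- §b `D` is the literal similitude `glDiagonal ![1, ϖ]`
  have hDgl : D = glDiagonal 2 (w.1.adicCompletion L) ![1, ϖ] := by
    refine Units.ext ?_
    rw [hD, coe_glDiagonal]
    ext i j; fin_cases i <;> fin_cases j <;> simp
  -- §c the VERTEX DOCKING at `w` (★ A-p03): every `ϖ`-modular frame factors through `D`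
  have hB : ∀ g : GL (Fin 2) (w.1.adicCompletion L), (∃ J' ∈ glInt 2 (w.1.adicCompletion L), (ϖ : w.1.adicCompletion L) • (J' : Matrix (Fin 2) (Fin 2) (w.1.adicCompletion L)) =
        formCongr (galAdicCompletionMap (L := L) (IsCMField.complexConj L) hw) g (((isUnit_placeForm_antidiagOne (E := L) 2 w.1).unit : GL (Fin 2) (w.1.adicCompletion L)) : Matrix (Fin 2) (Fin 2) (w.1.adicCompletion L))) →
      ∃ y ∈ unitaryGroupOfForm (galAdicCompletionMap (L := L) (IsCMField.complexConj L) hw) (placeForm (Matrix.of fun i j : Fin 2 => if i.val + j.val + 1 = 2 then (1 : L) else 0) w.1), ∃ k ∈ glInt 2 (w.1.adicCompletion L), g = y * D * k := by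
    intro g hg
    obtain ⟨y, hy, k, hk, rfl⟩ := exists_mem_unitaryGroupOfForm_mul_glDiagonal_mul_of_modular_of_ramified L v w hw he h2 ϖ hϖ g hg
    exact ⟨y, hy, k, hk, by rw [hDgl]⟩
  -- §d the Gram matrix of `D`: `ᵗσ(D)(Φ₂)_w D = ϖ • [[0,1],[−1,0]]`
  have hDform : ∃ J' ∈ glInt 2 (w.1.adicCompletion L), (ϖ : w.1.adicCompletion L) • (J' : Matrix (Fin 2) (Fin 2) (w.1.adicCompletion L)) =
      formCongr (galAdicCompletionMap (L := L) (IsCMField.complexConj L) hw) D (((isUnit_placeForm_antidiagOne (E := L) 2 w.1).unit : GL (Fin 2) (w.1.adicCompletion L)) : Matrix (Fin 2) (Fin 2) (w.1.adicCompletion L)) := by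
    obtain ⟨J', hJ'I, hJ'e⟩ := exists_glInt_coe_eq_sharp' (F := w.1.adicCompletion L)
    refine ⟨J', hJ'I, ?_⟩
    rw [hJ'e, hJ]
    show (ϖ : w.1.adicCompletion L) • (!![0, 1; -1, 0] : Matrix (Fin 2) (Fin 2) (w.1.adicCompletion L)) = ((D : Matrix (Fin 2) (Fin 2) (w.1.adicCompletion L)).map (galAdicCompletionMap (L := L) (IsCMField.complexConj L) hw))ᵀ * !![0, 1; 1, 0] * (D : Matrix (Fin 2) (Fin 2) (w.1.adicCompletion L))
    rw [hD]
    ext i j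
    fin_cases i <;> fin_cases j <;> simp [Matrix.mul_apply, Fin.sum_univ_two, hσϖ]
  -- §e FINITENESS of `Fix_{E₂ x.1}(U ⧸ K♯_D)` (★ V1 + ★ V1 docking + ★ R2-E finite modular set)
  have hγSh : ((E₂ x.1 : ↥(unitaryGroupOfForm (galAdicCompletionMap (L := L) (IsCMField.complexConj L) hw) (placeForm (Matrix.of fun i j : Fin 2 => if i.val + j.val + 1 = 2 then (1 : L) else 0) w.1))) : GL (Fin 2) (w.1.adicCompletion L)) ∈ Literature.AlgebraicGeometry.ShimuraVarieties.unitaryGroup (galAdicCompletionMap (L := L) (IsCMField.complexConj L) hw) (placeForm (Matrix.of fun i j : Fin 2 => if i.val + j.val + 1 = 2 then (1 : L) else 0) w.1) := by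
    rw [Literature.AlgebraicGeometry.ShimuraVarieties.unitaryGroup_eq_unitaryGroupOfForm]; exact (E₂ x.1).2
  have hfinS := finite_modularStable_antidiagTwo_at_ramified L v w hw he h2 ϖ hϖ hσϖ hγSh hQ hu hu1 hN'
  have hfin : (MulAction.fixedBy (↥(unitaryGroupOfForm (galAdicCompletionMap (L := L) (IsCMField.complexConj L) hw) (placeForm (Matrix.of fun i j : Fin 2 => if i.val + j.val + 1 = 2 then (1 : L) else 0) w.1)) ⧸ ((glInt 2 (w.1.adicCompletion L)).map (MulAut.conj D).toMonoidHom).subgroupOf (unitaryGroupOfForm (galAdicCompletionMap (L := L) (IsCMField.complexConj L) hw) (placeForm (Matrix.of fun i j : Fin 2 => if i.val + j.val + 1 = 2 then (1 : L) else 0) w.1))) (E₂ x.1)).Finite := by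
    refine finite_fixedBy_conj_unitary_of_finite (galAdicCompletionMap (L := L) (IsCMField.complexConj L) hw) (isUnit_placeForm_antidiagOne (E := L) 2 w.1).unit D (E₂ x.1) ?_
    refine hfinS.subset fun Λ hΛ => ?_
    obtain ⟨hU, hstab, -⟩ := hΛ
    exact ⟨(exists_mem_unitary_span_mul_eq_iff_modular (galAdicCompletionMap (L := L) (IsCMField.complexConj L) hw) (isUnit_placeForm_antidiagOne (E := L) 2 w.1).unit D hDform hB Λ).1 hU, hstab⟩
  -- §f ★ V2 for the one-place function `y ↦ φ (E₂⁻¹ y, x.2)`: `Ad K♯_D`-invariance and right-`Km`-invariance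
  have hφAd : ∀ k ∈ ((glInt 2 (w.1.adicCompletion L)).map (MulAut.conj D).toMonoidHom).subgroupOf (unitaryGroupOfForm (galAdicCompletionMap (L := L) (IsCMField.complexConj L) hw) (placeForm (Matrix.of fun i j : Fin 2 => if i.val + j.val + 1 = 2 then (1 : L) else 0) w.1)), ∀ y : ↥(unitaryGroupOfForm (galAdicCompletionMap (L := L) (IsCMField.complexConj L) hw) (placeForm (Matrix.of fun i j : Fin 2 => if i.val + j.val + 1 = 2 then (1 : L) else 0) w.1)), (fun y : ↥(unitaryGroupOfForm (galAdicCompletionMap (L := L) (IsCMField.complexConj L) hw) (placeForm (Matrix.of fun i j : Fin 2 => if i.val + j.val + 1 = 2 then (1 : L) else 0) w.1)) => φ (E₂.symm y, x.2)) (k * y * k⁻¹) = (fun y : ↥(unitaryGroupOfForm (galAdicCompletionMap (L := L) (IsCMField.complexConj L) hw) (placeForm (Matrix.of fun i j : Fin 2 => if i.val + j.val + 1 = 2 then (1 : L) else 0) w.1)) => φ (E₂.symm y, x.2)) y := by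
    intro k hk y
    show φ (E₂.symm (k * y * k⁻¹), x.2) = φ (E₂.symm y, x.2)
    have hk' : (E₂.symm k, (1 : (cmDatum L 1 (Matrix.of fun i j : Fin 1 => if i.val + j.val + 1 = 1 then (1 : L) else 0)).Local v)) ∈ (K.prod (⊤ : Subgroup ((cmDatum L 1 (Matrix.of fun i j : Fin 1 => if i.val + j.val + 1 = 1 then (1 : L) else 0)).Local v)) : Subgroup ((cmDatum L 2 (Matrix.of fun i j : Fin 2 => if i.val + j.val + 1 = 2 then (1 : L) else 0)).Local v × (cmDatum L 1 (Matrix.of fun i j : Fin 1 => if i.val + j.val + 1 = 1 then (1 : L) else 0)).Local v)) := by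
      refine Subgroup.mem_prod.2 ⟨(hK _).2 ?_, Subgroup.mem_top _⟩
      rw [ContinuousMulEquiv.apply_symm_apply]
      exact hk
    have h := hφK _ hk' (E₂.symm y, x.2)
    rw [map_mul, map_mul, map_inv]
    simpa only [Prod.mk_mul_mk, Prod.inv_mk, inv_one, one_mul, mul_one] using h
  have hφm' : ∀ z : ↥(unitaryGroupOfForm (galAdicCompletionMap (L := L) (IsCMField.complexConj L) hw) (placeForm (Matrix.of fun i j : Fin 2 => if i.val + j.val + 1 = 2 then (1 : L) else 0) w.1)), ∀ y ∈ Km, (fun y : ↥(unitaryGroupOfForm (galAdicCompletionMap (L := L) (IsCMField.complexConj L) hw) (placeForm (Matrix.of fun i j : Fin 2 => if i.val + j.val + 1 = 2 then (1 : L) else 0) w.1)) => φ (E₂.symm y, x.2)) (z * y) = (fun y : ↥(unitaryGroupOfForm (galAdicCompletionMap (L := L) (IsCMField.complexConj L) hw) (placeForm (Matrix.of fun i j : Fin 2 => if i.val + j.val + 1 = 2 then (1 : L) else 0) w.1)) => φ (E₂.symm y, x.2)) z :=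
    fun z y hy => hφm z y hy
  obtain ⟨e, xm, xs, he1, hbit, hxm, hxs, hsum⟩ := finsum_fixedBy_conj_eq_signedDepthExpansion_ramified_modular (galAdicCompletionMap (L := L) (IsCMField.complexConj L) hw) hϖ' hσϖ σO hσO' hσσ h2O hres hηu hση hη hq
    (isUnit_placeForm_antidiagOne (E := L) 2 w.1).unit hJ D hD (γ := E₂ x.1) hQ hu hu1 huv hN' hQh (hh' 0) (hh' 1) hσh r hr hsq hB hfin hmN Km hKm
    (fun y : ↥(unitaryGroupOfForm (galAdicCompletionMap (L := L) (IsCMField.complexConj L) hw) (placeForm (Matrix.of fun i j : Fin 2 => if i.val + j.val + 1 = 2 then (1 : L) else 0) w.1)) => φ (E₂.symm y, x.2)) hφAd hφm'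
  refine ⟨e, xm, xs, he1, hbit, hxm, hxs, ?_⟩
  -- §g ★ I-7 at `K′ := K♯_D`
  rw [integral_conj_eq_smul_finsum_onePlace_of_isCompact L v w hw ν K (((glInt 2 (w.1.adicCompletion L)).map (MulAut.conj D).toMonoidHom).subgroupOf (unitaryGroupOfForm (galAdicCompletionMap (L := L) (IsCMField.complexConj L) hw) (placeForm (Matrix.of fun i j : Fin 2 => if i.val + j.val + 1 = 2 then (1 : L) else 0) w.1))) E₂ hK hKo hKν x φ hφs hφK hc]
  exact congrArg (fun z : E => ν.real ((K.prod (⊤ : Subgroup ((cmDatum L 1 (Matrix.of fun i j : Fin 1 => if i.val + j.val + 1 = 1 then (1 : L) else 0)).Local v)) : Subgroup ((cmDatum L 2 (Matrix.of fun i j : Fin 2 => if i.val + j.val + 1 = 2 then (1 : L) else 0)).Local v × (cmDatum L 1 (Matrix.of fun i j : Fin 1 => if i.val + j.val + 1 = 1 then (1 : L) else 0)).Local v)) : Set ((cmDatum L 2 (Matrix.of fun i j : Fin 2 => if i.val + j.val + 1 = 2 then (1 : L) else 0)).Local v × (cmDatum L 1 (Matrix.of fun i j : Fin 1 => if i.val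 + j.val + 1 = 1 then (1 : L) else 0)).Local v)) • z) hsum

/-- Parity bits are unique: two `e, e' ≤ 1` characterised by the same proposition agree. [cite: Rogawski1990, §4.9 p. 54] -/
private theorem eq_of_iff_eq_zero_of_le_one_V3 {X : Prop} {e e' : ℕ} (he : e ≤ 1) (he' : e' ≤ 1) (h : e = 0 ↔ X) (h' : e' = 0 ↔ X) : e' = e := by
  rcases Nat.le_one_iff_eq_zero_or_eq_one.1 he with rfl | rfl <;> rcases Nat.le_one_iff_eq_zero_or_eq_one.1 he' with rfl | rfl
  · rfl
  · exact absurd (h'.2 (h.1 rfl)) one_ne_zero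
  · exact absurd (h.2 (h'.1 rfl)) one_ne_zero
  · rfl

-- `L_w`-sized statement: elaboration budget only (no search)
set_option maxHeartbeats 1600000 in
set_option synthInstance.maxHeartbeats 200000 in
include hw in
/-- **V3, CHOICE-FREE FORM** (for the R5b-PAIR ∕ END assembler): same hypotheses as `integral_conj_eq_smul_signedDepthExpansion_onePlace_ramified_modular` plus `Odd N`
(★ B-p12 `odd_of_valuation_sub_eq_of_norm_one`); for ANY `e : ℕ → ℕ` with `e i ≤ 1` and, for even `i < m`, the VERTEX characterisation, ANY `xm ∈ U` with matrix `u₁·1` and ANY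
`xs i ∈ U` (even `i < m`) with the `D`-conjugated matrices, the expansion holds with THESE points (odd `i < m` carry weight `0` since `N` is odd).
[cite: LabesseLanglands1979, §2 Lemma 2.1 pp. 8–9] [cite: Rogawski1990, §4.9 pp. 54–56, Lemma 4.9.3] [cite: Kottwitz1988, §2] -/
theorem integral_conj_eq_smul_signedDepthExpansion_onePlace_ramified_modular_of_coe_eq
    (he : v.asIdeal.ramificationIdx' w.1.asIdeal ≠ 1) (h2 : Valued.v (2 : w.1.adicCompletion L) = 1)
    (ϖ : (w.1.adicCompletion L)ˣ) (hϖ : Valued.v (ϖ : w.1.adicCompletion L) = WithZero.exp (-1 : ℤ)) (hσϖ : galAdicCompletionMap (L := L) (IsCMField.complexConj L) hw (ϖ : w.1.adicCompletion L) = -(ϖ : w.1.adicCompletion L))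
    (σO : 𝒪[w.1.adicCompletion L] →+* 𝒪[w.1.adicCompletion L]) (hσO' : ∀ x : 𝒪[w.1.adicCompletion L], ((σO x : 𝒪[w.1.adicCompletion L]) : w.1.adicCompletion L) = galAdicCompletionMap (L := L) (IsCMField.complexConj L) hw x)
    (hσσ : ∀ x, σO (σO x) = x) (hres : ∀ x : 𝒪[w.1.adicCompletion L], σO x - x ∈ IsLocalRing.maximalIdeal 𝒪[w.1.adicCompletion L])
    {η : 𝒪[w.1.adicCompletion L]} (hηu : IsUnit η) (hση : σO η = η) (hη : ¬ IsSquare (IsLocalRing.residue 𝒪[w.1.adicCompletion L] η))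
    (D : GL (Fin 2) (w.1.adicCompletion L)) (hD : (D : Matrix (Fin 2) (Fin 2) (w.1.adicCompletion L)) = !![1, 0; 0, (ϖ : w.1.adicCompletion L)])
    (K : Subgroup ((cmDatum L 2 (Matrix.of fun i j : Fin 2 => if i.val + j.val + 1 = 2 then (1 : L) else 0)).Local v)) (E₂ : (cmDatum L 2 (Matrix.of fun i j : Fin 2 => if i.val + j.val + 1 = 2 then (1 : L) else 0)).Local v ≃ₜ* ↥(unitaryGroupOfForm (galAdicCompletionMap (L := L) (IsCMField.complexConj L) hw) (placeForm (Matrix.of fun i j : Fin 2 => if i.val + j.val + 1 = 2 then (1 : L) else 0) w.1))) (hK : ∀ g, g ∈ K ↔ E₂ g ∈ ((glInt 2 (w.1.adicCompletion L)).map (MulAut.conj D).toMonoidHom).subgroupOf (unitaryGroupOfForm (galAdicCompletionMap (L := L) (IsCMField.complexConj L) hw) (placeForm (Matrix.of fun i j : Fin 2 => if i.val + j.val + 1 = 2 then (1 : L) else 0) w.1)))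
    (hKo : IsOpen ((K.prod (⊤ : Subgroup ((cmDatum L 1 (Matrix.of fun i j : Fin 1 => if i.val + j.val + 1 = 1 then (1 : L) else 0)).Local v)) : Subgroup ((cmDatum L 2 (Matrix.of fun i j : Fin 2 => if i.val + j.val + 1 = 2 then (1 : L) else 0)).Local v × (cmDatum L 1 (Matrix.of fun i j : Fin 1 => if i.val + j.val + 1 = 1 then (1 : L) else 0)).Local v)) : Set ((cmDatum L 2 (Matrix.of fun i j : Fin 2 => if i.val + j.val + 1 = 2 then (1 : L) else 0)).Local v × (cmDatum L 1 (Matrix.of fun i j : Fin 1 => if i.val + j.val + 1 = 1 then (1 : L) else 0)).Local v)))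
    (hKν : ν ((K.prod (⊤ : Subgroup ((cmDatum L 1 (Matrix.of fun i j : Fin 1 => if i.val + j.val + 1 = 1 then (1 : L) else 0)).Local v)) : Subgroup ((cmDatum L 2 (Matrix.of fun i j : Fin 2 => if i.val + j.val + 1 = 2 then (1 : L) else 0)).Local v × (cmDatum L 1 (Matrix.of fun i j : Fin 1 => if i.val + j.val + 1 = 1 then (1 : L) else 0)).Local v)) : Set ((cmDatum L 2 (Matrix.of fun i j : Fin 2 => if i.val + j.val + 1 = 2 then (1 : L) else 0)).Local v × (cmDatum L 1 (Matrix.of fun i j : Fin 1 => if i.val + j.val + 1 = 1 then (1 : L) else 0)).Local v)) ≠ ⊤)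
    (x : ((cmDatum L 2 (Matrix.of fun i j : Fin 2 => if i.val + j.val + 1 = 2 then (1 : L) else 0)).Local v × (cmDatum L 1 (Matrix.of fun i j : Fin 1 => if i.val + j.val + 1 = 1 then (1 : L) else 0)).Local v)) {Q : GL (Fin 2) (w.1.adicCompletion L)} {u : Fin 2 → w.1.adicCompletion L}
    (hQ : (((E₂ x.1 : ↥(unitaryGroupOfForm (galAdicCompletionMap (L := L) (IsCMField.complexConj L) hw) (placeForm (Matrix.of fun i j : Fin 2 => if i.val + j.val + 1 = 2 then (1 : L) else 0) w.1))) : GL (Fin 2) (w.1.adicCompletion L)) : Matrix (Fin 2) (Fin 2) (w.1.adicCompletion L)) * (Q : Matrix (Fin 2) (Fin 2) (w.1.adicCompletion L)) = (Q : Matrix (Fin 2) (Fin 2) (w.1.adicCompletion L)) * diagonal u) (hu : Function.Injective u)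
    (hu1 : ∀ i, galAdicCompletionMap (L := L) (IsCMField.complexConj L) hw (u i) * u i = 1) {N : ℕ} (hN : Valued.v (u 0 - u 1) = Valued.v (ϖ : w.1.adicCompletion L) ^ N) (hN1 : Odd N)
    {h : Fin 2 → w.1.adicCompletion L} (hQh : formCongr (galAdicCompletionMap (L := L) (IsCMField.complexConj L) hw) Q (placeForm (Matrix.of fun i j : Fin 2 => if i.val + j.val + 1 = 2 then (1 : L) else 0) w.1) = Matrix.diagonal h) (hh : ∀ i, Valued.v (h i) = 1)
    (hσh : ∀ i, galAdicCompletionMap (L := L) (IsCMField.complexConj L) hw (h i) = h i) (r : 𝒪[w.1.adicCompletion L]) (hr : h 0 * (r : w.1.adicCompletion L) = -h 1) (hsq : IsSquare (IsLocalRing.residue 𝒪[w.1.adicCompletion L] r))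
    {m : ℕ} (hmN : m ≤ N) (Km : Subgroup ↥(unitaryGroupOfForm (galAdicCompletionMap (L := L) (IsCMField.complexConj L) hw) (placeForm (Matrix.of fun i j : Fin 2 => if i.val + j.val + 1 = 2 then (1 : L) else 0) w.1)))
    (hKm : ∀ y : ↥(unitaryGroupOfForm (galAdicCompletionMap (L := L) (IsCMField.complexConj L) hw) (placeForm (Matrix.of fun i j : Fin 2 => if i.val + j.val + 1 = 2 then (1 : L) else 0) w.1)), (∀ r s, (ϖ : w.1.adicCompletion L) ^ (-(m : ℤ)) *
      ((((D⁻¹ * ((y : ↥(unitaryGroupOfForm (galAdicCompletionMap (L := L) (IsCMField.complexConj L) hw) (placeForm (Matrix.of fun i j : Fin 2 => if i.val + j.val + 1 = 2 then (1 : L) else 0) w.1))) : GL (Fin 2) (w.1.adicCompletion L)) * D : GL (Fin 2) (w.1.adicCompletion L))) : Matrix (Fin 2) (Fin 2) (w.1.adicCompletion L)) - 1) r s ∈ 𝒪[w.1.adicCompletion L]) → y ∈ Km)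
    (φ : ((cmDatum L 2 (Matrix.of fun i j : Fin 2 => if i.val + j.val + 1 = 2 then (1 : L) else 0)).Local v × (cmDatum L 1 (Matrix.of fun i j : Fin 1 => if i.val + j.val + 1 = 1 then (1 : L) else 0)).Local v) → E) (hφs : support φ ⊆ ((K.prod (⊤ : Subgroup ((cmDatum L 1 (Matrix.of fun i j : Fin 1 => if i.val + j.val + 1 = 1 then (1 : L) else 0)).Local v)) : Subgroup ((cmDatum L 2 (Matrix.of fun i j : Fin 2 => if i.val + j.val + 1 = 2 then (1 : L) else 0)).Local v × (cmDatum L 1 (Matrix.of fun i j : Fin 1 => if i.val + j.val + 1 = 1 then (1 : L) else 0)).Local v)) : Set ((cmDatum L 2 (Matrix.of fun i j : Fin 2 => if i.val + j.val + 1 = 2 then (1 : L) else 0)).Local v × (cmDatum L 1 (Matrix.of fun i j : Fin 1 => if i.val + j.val + 1 = 1 then (1 : L) else 0)).Local v)))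
    (hφK : ∀ k ∈ (K.prod (⊤ : Subgroup ((cmDatum L 1 (Matrix.of fun i j : Fin 1 => if i.val + j.val + 1 = 1 then (1 : L) else 0)).Local v)) : Subgroup ((cmDatum L 2 (Matrix.of fun i j : Fin 2 => if i.val + j.val + 1 = 2 then (1 : L) else 0)).Local v × (cmDatum L 1 (Matrix.of fun i j : Fin 1 => if i.val + j.val + 1 = 1 then (1 : L) else 0)).Local v)), ∀ y, φ (k * y * k⁻¹) = φ y)
    (hφm : ∀ x' : ↥(unitaryGroupOfForm (galAdicCompletionMap (L := L) (IsCMField.complexConj L) hw) (placeForm (Matrix.of fun i j : Fin 2 => if i.val + j.val + 1 = 2 then (1 : L) else 0) w.1)), ∀ y ∈ Km, φ (E₂.symm (x' * y), x.2) = φ (E₂.symm x', x.2))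
    (hc : IsCompact {y : ((cmDatum L 2 (Matrix.of fun i j : Fin 2 => if i.val + j.val + 1 = 2 then (1 : L) else 0)).Local v × (cmDatum L 1 (Matrix.of fun i j : Fin 1 => if i.val + j.val + 1 = 1 then (1 : L) else 0)).Local v) | y * x * y⁻¹ ∈ ((K.prod (⊤ : Subgroup ((cmDatum L 1 (Matrix.of fun i j : Fin 1 => if i.val + j.val + 1 = 1 then (1 : L) else 0)).Local v)) : Subgroup ((cmDatum L 2 (Matrix.of fun i j : Fin 2 => if i.val + j.val + 1 = 2 then (1 : L) else 0)).Local v × (cmDatum L 1 (Matrix.of fun i j : Fin 1 => if i.val + j.val + 1 = 1 then (1 : L) else 0)).Local v)) : Set ((cmDatum L 2 (Matrix.of fun i j : Fin 2 => if i.val + j.val + 1 = 2 then (1 : L) else 0)).Local v × (cmDatum L 1 (Matrix.of fun i j : Fin 1 => if i.val + j.val + 1 = 1 then (1 : L) else 0)).Local v))})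
    (e : ℕ → ℕ) (he1 : ∀ i, e i ≤ 1)
    (hbit : ∀ i < m, Even i → ∀ S : 𝒪[w.1.adicCompletion L], (S : w.1.adicCompletion L) = (-1) ^ ((N + i + 1) / 2 + 1) * u 1 * ((u 0 - u 1) * ((ϖ : w.1.adicCompletion L) ^ N)⁻¹) * (-h 0) →
      (e i = 0 ↔ IsSquare (IsLocalRing.residue 𝒪[w.1.adicCompletion L] S)))
    (xm : ↥(unitaryGroupOfForm (galAdicCompletionMap (L := L) (IsCMField.complexConj L) hw) (placeForm (Matrix.of fun i j : Fin 2 => if i.val + j.val + 1 = 2 then (1 : L) else 0) w.1))) (hxm : (((xm : ↥(unitaryGroupOfForm (galAdicCompletionMap (L := L) (IsCMField.complexConj L) hw) (placeForm (Matrix.of fun i j : Fin 2 => if i.val + j.val + 1 = 2 then (1 : L) else 0) w.1))) : GL (Fin 2) (w.1.adicCompletion L)) : Matrix (Fin 2) (Fin 2) (w.1.adicCompletion L)) = u 1 • (1 : Matrix (Fin 2) (Fin 2) (w.1.adicCompletion L)))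
    (xs : ℕ → ↥(unitaryGroupOfForm (galAdicCompletionMap (L := L) (IsCMField.complexConj L) hw) (placeForm (Matrix.of fun i j : Fin 2 => if i.val + j.val + 1 = 2 then (1 : L) else 0) w.1)))
    (hxs : ∀ i < m, Even i → (((xs i : ↥(unitaryGroupOfForm (galAdicCompletionMap (L := L) (IsCMField.complexConj L) hw) (placeForm (Matrix.of fun i j : Fin 2 => if i.val + j.val + 1 = 2 then (1 : L) else 0) w.1))) : GL (Fin 2) (w.1.adicCompletion L)) : Matrix (Fin 2) (Fin 2) (w.1.adicCompletion L)) = u 1 • ((1 : Matrix (Fin 2) (Fin 2) (w.1.adicCompletion L)) +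
      (ϖ : w.1.adicCompletion L) ^ i • ((D : Matrix (Fin 2) (Fin 2) (w.1.adicCompletion L)) * !![0, ((η : 𝒪[w.1.adicCompletion L]) : w.1.adicCompletion L) ^ (e i); 0, 0] * ((D⁻¹ : GL (Fin 2) (w.1.adicCompletion L)) : Matrix (Fin 2) (Fin 2) (w.1.adicCompletion L))))) :
    ∫ y, φ (y * x * y⁻¹) ∂ν = ν.real ((K.prod (⊤ : Subgroup ((cmDatum L 1 (Matrix.of fun i j : Fin 1 => if i.val + j.val + 1 = 1 then (1 : L) else 0)).Local v)) : Subgroup ((cmDatum L 2 (Matrix.of fun i j : Fin 2 => if i.val + j.val + 1 = 2 then (1 : L) else 0)).Local v × (cmDatum L 1 (Matrix.of fun i j : Fin 1 => if i.val + j.val + 1 = 1 then (1 : L) else 0)).Local v)) : Set ((cmDatum L 2 (Matrix.of fun i j : Fin 2 => if i.val + j.val + 1 = 2 then (1 : L) else 0)).Local v × (cmDatum L 1 (Matrix.of fun i j : Fin 1 => if i.val + j.val + 1 = 1 then (1 : L) else 0)).Local v)) •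
      ((∑ j ∈ (range (N + 1)).filter (fun j => j % 2 = 1 ∧ j + m ≤ N), (if j = 0 then 1 else 2 * Nat.card (𝓞 ↥(maximalRealSubfield L) ⧸ v.asIdeal) ^ (j / 2))) • φ (E₂.symm xm, x.2) +
        ∑ i ∈ range m, (if i ≤ N ∧ (N - i) % 2 = 1 then (if N - i = 0 then 1 else 2 * Nat.card (𝓞 ↥(maximalRealSubfield L) ⧸ v.asIdeal) ^ ((N - i) / 2)) else 0) • φ (E₂.symm (xs i), x.2)) := by
  obtain ⟨e₀, xm₀, xs₀, he₀, hbit₀, hxm₀, hxs₀, hEQ⟩ := integral_conj_eq_smul_signedDepthExpansion_onePlace_ramified_modular L v w hw ν he h2 ϖ hϖ hσϖ σO hσO' hσσ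
    hres hηu hση hη D hD K E₂ hK hKo hKν x hQ hu hu1 hN hQh hh hσh r hr hsq hmN Km hKm φ hφs hφK hφm hc
  -- the sign data `S i` are INTEGERS (products of units), so both characterisations are comparable
  have hϖ0 : (ϖ : w.1.adicCompletion L) ≠ 0 := ϖ.ne_zero
  have hu1O : u 1 ∈ 𝒪[w.1.adicCompletion L] := (Valuation.mem_integer_iff _ _).2 (valuation_eq_one_of_galAdicCompletionMap_mul_self L v w hw (hu1 1)).le
  have hh0O : -h 0 ∈ 𝒪[w.1.adicCompletion L] := neg_mem ((Valuation.mem_integer_iff _ _).2 ((v_eq_one_iff_valuation_eq_one (h 0)).1 (hh 0)).le)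
  have hwO : (u 0 - u 1) * ((ϖ : w.1.adicCompletion L) ^ N)⁻¹ ∈ 𝒪[w.1.adicCompletion L] := by
    refine (Valuation.mem_integer_iff _ _).2 (le_of_eq ?_)
    have hN' : valuation (w.1.adicCompletion L) (u 0 - u 1) = valuation (w.1.adicCompletion L) ((ϖ : w.1.adicCompletion L) ^ N) := by rw [← v_eq_iff_valuation_eq, hN, map_pow]
    have hϖN1 : valuation (w.1.adicCompletion L) ((ϖ : w.1.adicCompletion L) ^ N) ≠ 0 := (Valuation.ne_zero_iff _).2 (pow_ne_zero _ hϖ0)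
    rw [map_mul, map_inv₀, hN', mul_inv_cancel₀ hϖN1]
  have hSO : ∀ i : ℕ, (-1 : w.1.adicCompletion L) ^ ((N + i + 1) / 2 + 1) * u 1 * ((u 0 - u 1) * ((ϖ : w.1.adicCompletion L) ^ N)⁻¹) * (-h 0) ∈ 𝒪[w.1.adicCompletion L] :=
    fun i => mul_mem (mul_mem (mul_mem (pow_mem (neg_mem (one_mem _)) _) hu1O) hwO) hh0O
  have hee : ∀ i < m, Even i → e i = e₀ i := fun i him hie =>
    eq_of_iff_eq_zero_of_le_one_V3 (he₀ i) (he1 i) (hbit₀ i him hie ⟨_, hSO i⟩ rfl) (hbit i him hie ⟨_, hSO i⟩ rfl)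
  have hxm' : xm = xm₀ := Subtype.ext (Units.ext (hxm.trans hxm₀.symm))
  rw [hEQ, hxm']
  congr 2
  refine Finset.sum_congr rfl fun i hi => ?_
  have him : i < m := Finset.mem_range.1 hi
  by_cases hie : Even i
  · have hxs' : xs i = xs₀ i := Subtype.ext (Units.ext ((hxs i him hie).trans (by rw [hee i him hie, hxs₀ i hie])))
    rw [hxs']
  · -- odd `i`: `N − i` is even (`N` odd, `i ≤ N`), so the weight vanishes
    have hw0 : ¬ (i ≤ N ∧ (N - i) % 2 = 1) := by
      rintro ⟨hiN, hpar⟩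
      apply hie
      rcases hN1 with ⟨k, hk⟩
      exact ⟨i / 2, by omega⟩
    rw [if_neg hw0, zero_smul, zero_smul]

end Expansion

end Literature.NumberTheory.Rogawski1990

end
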